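import Mathlib
import HarnessLib
import Summits.Ventures.LatticeQCDFlow.Exactness.U1JitteredHMCAtomless
import Summits.Ventures.LatticeQCDFlow.Exactness.NCMCGeneralSpaceDoeblinPowerCLT
import Summits.Ventures.LatticeQCDFlow.Scoring.DoeblinPowerBatchMeansCLT
import Summits.Ventures.LatticeQCDFlow.Scoring.DoeblinPowerBatchMeansTauInt

/-!
# The `u1_2d` engine's JITTERED leapfrog HMC (any law of the step charging a short window): certified burn-in, the CLT, consistent batch-means error bars with asymptotically exact coverage and a consistent `τ̂_int`, from EVERY start

HONEST FRAMING: exact (Metropolis-corrected) sampling algorithms for lattice gauge theory;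
figures of merit are autocorrelation/cost numbers at stated couplings and volumes; no
continuum-physics claim.

Venture `LatticeQCDFlow` (cell pub-lqcd), topic `Exactness`, FANOUT row 9 (eng-latcore, GEN-25).  The engine
`latflow.core.u1_2d.U1Field2D.hmc_trajectory(β, τ, nstep, tau_jitter)`: the step `ε` is drawn from a law `η` before and
independently of the state (`UniformJitterLaw`: the code's law; `U1UniformJitterHMC`: the engine as run).  NEW WORK of the
cell: the FIGURES-OF-MERIT TWIN of GEN-23's `U1LeapfrogHMCFiguresOfMerit.lean` (fixed step) for GEN-24's jittered kernel
`u1JitterHMCL` (`U1JitteredHMCAtomless.lean`: `wilson_u1JitterHMCL_certificate` — whenever the law of the step charges a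
window `[ε₁, ε₂]`, `0 < ε₁ ≤ ε₂`, on which the increments are `K`-Lipschitz with `4Kε₂n² ≤ 3` and bounded, ONE
`0 < ε' ≤ 1` gives `ε' • Haar^{⊗E} ≤ K_jit(U, ·)` for EVERY `U`), composed with the cell's generic Doeblin ⇒ statistics
theorems (`GeneralNCMC.chain_timeAverage_bias_le_of_nHit`, `GeneralNCMC.tendstoInDistribution_timeAverage_of_nHit`,
`Scoring.chain_batchMeans_sigmaHat_tendstoInMeasure_of_nHit`, `Scoring.doeblinPower_batchMeans_studentized_coverage`,
`Scoring.chain_batchMeans_tauInt_tendstoInMeasure_of_nHit`).  Nothing is cited as a fact; no number is claimed.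

## Content

`wilson_u1JitterHMCL_certificate_nHit` (the certificate in one-hit form); **`wilson_u1JitterHMCL_timeAverage_bias_le`**
(burn-in `B/N'` from EVERY start, every `[0,1]`-valued observable); **`wilson_u1JitterHMCL_timeAverage_clt`** (the CLT
for time averages of bounded observables from EVERY initial law, variance `σ²_f = Var_π f + 2 Σ_k Cov_k`);
**`wilson_u1JitterHMCL_batchMeans_tendstoInMeasure`** (batch means estimate `σ²_f` consistently);
**`wilson_u1JitterHMCL_batchMeans_coverage`** (the studentized batch-means interval has asymptotically exact Gaussian
coverage); **`wilson_u1JitterHMCL_tauInt_tendstoInMeasure`** (the reported `τ̂_int = σ̂²_BM / (2 v̂)` is consistent).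

NOT CLAIMED: anything when the law of the step gives the window mass zero or `4Kε₂n² > 3`; any value of the constants
(they carry `η[ε₁, ε₂]`); that jitter improves any autocorrelation; floating point.
-/

noncomputable section

namespace Summit.Ventures.LatticeQCDFlow.Exactness

open MeasureTheory ProbabilityTheory Set Function Filter Topology
open Literature.MathematicalPhysics.QuantumFieldTheory
open Summit.Ventures.LatticeQCDFlow.Scoring (replicaSEsq tauInt autocov kop)
open scoped ENNReal NNReal

set_option backward.isDefEq.respectTransparency false

section U1Jitter

variable {d L N : ℕ} (ρ : Circle →* Matrix (Fin N) (Fin N) ℂ)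

/-- **THE ONE-HIT DOEBLIN CERTIFICATE OF THE JITTERED `u1_2d` HMC** (law of the step charging a short window): the
kernel leaves `wilsonMeasure ρ β` invariant and its first hit dominates `ε' · Haar^{⊗E}` from EVERY configuration,
`0 < ε' ≤ 1`. -/
theorem wilson_u1JitterHMCL_certificate_nHit [NeZero L] (hρ : Continuous ρ) (β : ℝ) {ε₁ ε₂ κ : ℝ}
    (hε₁ : 0 < ε₁) (h12 : ε₁ ≤ ε₂) (hκ : 0 < κ) {n : ℕ} (hn : 1 ≤ n)
    {g : ℝ → GaugeConfig d L Circle → Edge d L → ℝ} (hg : Measurable fun q : ℝ × GaugeConfig d L Circle => g q.1 q.2)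
    {K : ℝ≥0} (hgK : ∀ ε ∈ Icc ε₁ ε₂, LipschitzWith K (g ε)) (hshort : 4 * (K : ℝ) * ε₂ * (n : ℝ) ^ 2 ≤ 3)
    {b : ℝ} (hb0 : 0 ≤ b) (hb : ∀ ε ∈ Icc ε₁ ε₂, ∀ U e, ‖g ε U e‖ ≤ b)
    (η : Measure ℝ) [IsProbabilityMeasure η] (hη : η (Icc ε₁ ε₂) ≠ 0) :
    Kernel.Invariant (u1JitterHMCL measurable_id hg κ (fun U : GaugeConfig d L Circle => β * wilsonAction ρ U)
          (N := fun _ => n) measurable_const η) (wilsonMeasure (d := d) (L := L) ρ β) ∧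
      ∃ ε' : ℝ≥0∞, 0 < ε' ∧ ε' ≤ 1 ∧ ∀ U : GaugeConfig d L Circle,
        ε' • Measure.pi (fun _ : Edge d L => haarProbability Circle) ≤
          nHit (u1JitterHMCL measurable_id hg κ (fun U : GaugeConfig d L Circle => β * wilsonAction ρ U)
          (N := fun _ => n) measurable_const η) 1 U := by
  obtain ⟨hinv, ε', hε0, hε1, hmin⟩ :=
    wilson_u1JitterHMCL_certificate ρ hρ β hε₁ h12 hκ hn hg hgK hshort hb0 hb η hη
  exact ⟨hinv, ε', hε0, hε1, fun U => by rw [GeneralNCMC.nHit_one]; exact hmin U⟩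

/-! ## Figures of merit: burn-in, CLT, batch means, coverage, `τ̂_int` -/

/-- **CERTIFIED BURN-IN OF THE `u1_2d` JITTERED LEAPFROG HMC FROM EVERY START**: one `B ≥ 0` with
`|E_{μ₀}[(1/N') Σ_{t<N'} q(U_t)] − ∫ q dπ| ≤ B/N'` for EVERY initial law, every `[0,1]`-valued measurable `q`, `N' ≥ 1`. -/
theorem wilson_u1JitterHMCL_timeAverage_bias_le [NeZero L] (hρ : Continuous ρ) (β : ℝ) {ε₁ ε₂ κ : ℝ}
    (hε₁ : 0 < ε₁) (h12 : ε₁ ≤ ε₂) (hκ : 0 < κ) {n : ℕ} (hn : 1 ≤ n)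
    {g : ℝ → GaugeConfig d L Circle → Edge d L → ℝ} (hg : Measurable fun q : ℝ × GaugeConfig d L Circle => g q.1 q.2)
    {K : ℝ≥0} (hgK : ∀ ε ∈ Icc ε₁ ε₂, LipschitzWith K (g ε)) (hshort : 4 * (K : ℝ) * ε₂ * (n : ℝ) ^ 2 ≤ 3)
    {b : ℝ} (hb0 : 0 ≤ b) (hb : ∀ ε ∈ Icc ε₁ ε₂, ∀ U e, ‖g ε U e‖ ≤ b)
    (η : Measure ℝ) [IsProbabilityMeasure η] (hη : η (Icc ε₁ ε₂) ≠ 0)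
    [IsMarkovKernel (u1JitterHMCL measurable_id hg κ (fun U : GaugeConfig d L Circle => β * wilsonAction ρ U)
          (N := fun _ => n) measurable_const η)] :
    ∃ B : ℝ, 0 ≤ B ∧ ∀ (μ₀ : Measure (GaugeConfig d L Circle)) [IsProbabilityMeasure μ₀]
      (q : GaugeConfig d L Circle → ℝ), Measurable q → (∀ U, 0 ≤ q U) → (∀ U, q U ≤ 1) →
      ∀ N' : ℕ, N' ≠ 0 →
      |∫ x, (∑ t ∈ Finset.range N', q (x t)) / N'
          ∂(Kernel.trajMeasure (X := fun _ : ℕ => GaugeConfig d L Circle) μ₀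
              (fun t : ℕ => (u1JitterHMCL measurable_id hg κ (fun U : GaugeConfig d L Circle => β * wilsonAction ρ U)
          (N := fun _ => n) measurable_const η).comap
                (fun h : (i : ↥(Finset.Iic t)) → GaugeConfig d L Circle =>
                  h ⟨t, Finset.mem_Iic.2 le_rfl⟩) (measurable_pi_apply _)))
        - ∫ U, q U ∂(wilsonMeasure (d := d) (L := L) ρ β)| ≤ B / N' := by
  haveI := isProbabilityMeasure_wilsonMeasure (d := d) (L := L) ρ hρ β
  obtain ⟨hinv, ε', hε0, hε1, hmin⟩ := wilson_u1JitterHMCL_certificate_nHit (d := d) (L := L) ρ hρ β hε₁ h12 hκ hn hg hgK hshort hb0 hb η hη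
  have he0 : 0 < ε'.toReal := ENNReal.toReal_pos hε0.ne' (ne_top_of_le_ne_top ENNReal.one_ne_top hε1)
  refine ⟨1 / ε'.toReal, by positivity, fun μ₀ _ q hq h0 h1 N' hN => ?_⟩
  calc _ ≤ ((1 : ℕ) : ℝ) / (ε'.toReal * N') :=
        GeneralNCMC.chain_timeAverage_bias_le_of_nHit (GeneralNCMC.minorised_setwise hmin) hε0 hε1 Nat.one_pos
          hinv μ₀ hq h0 h1 hN
    _ = 1 / ε'.toReal / N' := by rw [Nat.cast_one, div_div]

/-- **THE CLT FOR TIME AVERAGES OF THE `u1_2d` JITTERED LEAPFROG HMC, FROM EVERY INITIAL LAW** (`|f| ≤ C` measurable,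
`Y ~ N(0, σ²_f)`): `(√N')⁻¹ Σ_{t<N'} (f(U_t) − π f) ⇒ Y` under `P_{μ₀}`. -/
theorem wilson_u1JitterHMCL_timeAverage_clt [NeZero L] (hρ : Continuous ρ) (β : ℝ) {ε₁ ε₂ κ : ℝ}
    (hε₁ : 0 < ε₁) (h12 : ε₁ ≤ ε₂) (hκ : 0 < κ) {n : ℕ} (hn : 1 ≤ n)
    {g : ℝ → GaugeConfig d L Circle → Edge d L → ℝ} (hg : Measurable fun q : ℝ × GaugeConfig d L Circle => g q.1 q.2)
    {K : ℝ≥0} (hgK : ∀ ε ∈ Icc ε₁ ε₂, LipschitzWith K (g ε)) (hshort : 4 * (K : ℝ) * ε₂ * (n : ℝ) ^ 2 ≤ 3)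
    {b : ℝ} (hb0 : 0 ≤ b) (hb : ∀ ε ∈ Icc ε₁ ε₂, ∀ U e, ‖g ε U e‖ ≤ b)
    (η : Measure ℝ) [IsProbabilityMeasure η] (hη : η (Icc ε₁ ε₂) ≠ 0)
    [IsMarkovKernel (u1JitterHMCL measurable_id hg κ (fun U : GaugeConfig d L Circle => β * wilsonAction ρ U)
          (N := fun _ => n) measurable_const η)]
    {f : GaugeConfig d L Circle → ℝ} (hf : Measurable f) {C : ℝ} (hC : ∀ U, |f U| ≤ C)
    (μ₀ : Measure (GaugeConfig d L Circle)) [IsProbabilityMeasure μ₀]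
    [IsProbabilityMeasure (Kernel.trajMeasure (X := fun _ : ℕ => GaugeConfig d L Circle) μ₀
              (fun t : ℕ => (u1JitterHMCL measurable_id hg κ (fun U : GaugeConfig d L Circle => β * wilsonAction ρ U)
          (N := fun _ => n) measurable_const η).comap
                (fun h : (i : ↥(Finset.Iic t)) → GaugeConfig d L Circle =>
                  h ⟨t, Finset.mem_Iic.2 le_rfl⟩) (measurable_pi_apply _)))]
    {Ω' : Type*} [MeasurableSpace Ω'] {P' : Measure Ω'} [IsProbabilityMeasure P'] {Y : Ω' → ℝ}
    (hY : HasLaw Y (gaussianReal 0 (Real.toNNReal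
      ((∫ y, (f y - ∫ z, f z ∂(wilsonMeasure (d := d) (L := L) ρ β)) ^ 2 ∂(wilsonMeasure (d := d) (L := L) ρ β))
              + 2 * ∑' k, ∫ y, (f y - ∫ z, f z ∂(wilsonMeasure (d := d) (L := L) ρ β))
                * (kop (u1JitterHMCL measurable_id hg κ (fun U : GaugeConfig d L Circle => β * wilsonAction ρ U)
          (N := fun _ => n) measurable_const η))^[k + 1]
                  (fun y => f y - ∫ z, f z ∂(wilsonMeasure (d := d) (L := L) ρ β)) y ∂(wilsonMeasure (d := d) (L := L) ρ β)))) P') :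
    TendstoInDistribution (fun (N' : ℕ) (x : ℕ → GaugeConfig d L Circle) =>
        (Real.sqrt N')⁻¹ * ∑ t ∈ Finset.range N', (f (x t) - ∫ z, f z ∂(wilsonMeasure (d := d) (L := L) ρ β)))
      atTop Y (fun _ => (Kernel.trajMeasure (X := fun _ : ℕ => GaugeConfig d L Circle) μ₀
              (fun t : ℕ => (u1JitterHMCL measurable_id hg κ (fun U : GaugeConfig d L Circle => β * wilsonAction ρ U)
          (N := fun _ => n) measurable_const η).comap
                (fun h : (i : ↥(Finset.Iic t)) → GaugeConfig d L Circle =>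
                  h ⟨t, Finset.mem_Iic.2 le_rfl⟩) (measurable_pi_apply _)))) P' := by
  haveI := isProbabilityMeasure_wilsonMeasure (d := d) (L := L) ρ hρ β
  obtain ⟨hinv, ε', hε0, -, hmin⟩ := wilson_u1JitterHMCL_certificate_nHit (d := d) (L := L) ρ hρ β hε₁ h12 hκ hn hg hgK hshort hb0 hb η hη
  exact GeneralNCMC.tendstoInDistribution_timeAverage_of_nHit hinv hε0.ne' hmin Nat.one_pos hf hC μ₀ hY

/-- **BATCH MEANS ESTIMATE `σ²_f` CONSISTENTLY ALONG THE `u1_2d` JITTERED LEAPFROG HMC, FROM EVERY INITIAL LAW.** -/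
theorem wilson_u1JitterHMCL_batchMeans_tendstoInMeasure [NeZero L] (hρ : Continuous ρ) (β : ℝ) {ε₁ ε₂ κ : ℝ}
    (hε₁ : 0 < ε₁) (h12 : ε₁ ≤ ε₂) (hκ : 0 < κ) {n : ℕ} (hn : 1 ≤ n)
    {g : ℝ → GaugeConfig d L Circle → Edge d L → ℝ} (hg : Measurable fun q : ℝ × GaugeConfig d L Circle => g q.1 q.2)
    {K : ℝ≥0} (hgK : ∀ ε ∈ Icc ε₁ ε₂, LipschitzWith K (g ε)) (hshort : 4 * (K : ℝ) * ε₂ * (n : ℝ) ^ 2 ≤ 3)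
    {b : ℝ} (hb0 : 0 ≤ b) (hb : ∀ ε ∈ Icc ε₁ ε₂, ∀ U e, ‖g ε U e‖ ≤ b)
    (η : Measure ℝ) [IsProbabilityMeasure η] (hη : η (Icc ε₁ ε₂) ≠ 0)
    [IsMarkovKernel (u1JitterHMCL measurable_id hg κ (fun U : GaugeConfig d L Circle => β * wilsonAction ρ U)
          (N := fun _ => n) measurable_const η)]
    {f : GaugeConfig d L Circle → ℝ} (hf : Measurable f) {C : ℝ} (hC : ∀ U, |f U| ≤ C)
    (μ₀ : Measure (GaugeConfig d L Circle)) [IsProbabilityMeasure μ₀]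
    {a b' : ℕ → ℕ} (ha : Tendsto a atTop atTop) (hb' : Tendsto b' atTop atTop) :
    TendstoInMeasure (Kernel.trajMeasure (X := fun _ : ℕ => GaugeConfig d L Circle) μ₀
              (fun t : ℕ => (u1JitterHMCL measurable_id hg κ (fun U : GaugeConfig d L Circle => β * wilsonAction ρ U)
          (N := fun _ => n) measurable_const η).comap
                (fun h : (i : ↥(Finset.Iic t)) → GaugeConfig d L Circle =>
                  h ⟨t, Finset.mem_Iic.2 le_rfl⟩) (measurable_pi_apply _)))
      (fun (N' : ℕ) (x : ℕ → GaugeConfig d L Circle) => ((b' N' * a N' : ℕ) : ℝ)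
        * replicaSEsq (fun j (x : ℕ → GaugeConfig d L Circle) =>
            (∑ i ∈ Finset.range (b' N'), f (x (b' N' * j + i))) / (b' N')) (a N') x)
      atTop (fun _ => (∫ y, (f y - ∫ z, f z ∂(wilsonMeasure (d := d) (L := L) ρ β)) ^ 2 ∂(wilsonMeasure (d := d) (L := L) ρ β))
              + 2 * ∑' k, ∫ y, (f y - ∫ z, f z ∂(wilsonMeasure (d := d) (L := L) ρ β))
                * (kop (u1JitterHMCL measurable_id hg κ (fun U : GaugeConfig d L Circle => β * wilsonAction ρ U)
          (N := fun _ => n) measurable_const η))^[k + 1]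
                  (fun y => f y - ∫ z, f z ∂(wilsonMeasure (d := d) (L := L) ρ β)) y ∂(wilsonMeasure (d := d) (L := L) ρ β)) := by
  haveI := isProbabilityMeasure_wilsonMeasure (d := d) (L := L) ρ hρ β
  obtain ⟨hinv, ε', hε0, hε1, hmin⟩ := wilson_u1JitterHMCL_certificate_nHit (d := d) (L := L) ρ hρ β hε₁ h12 hκ hn hg hgK hshort hb0 hb η hη
  exact Scoring.chain_batchMeans_sigmaHat_tendstoInMeasure_of_nHit hinv (GeneralNCMC.minorised_setwise hmin)
    hε0 hε1 Nat.one_pos hf hC μ₀ ha hb'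

/-- **THE BATCH-MEANS INTERVAL OF A `u1_2d` JITTERED HMC RUN IS ASYMPTOTICALLY EXACT** (`σ²_f > 0`, any initial law,
`z > 0`): `P_{μ₀}(|√(ab) (f̄_{ab} − π f)| ≤ z σ̂_BM) → (gaussianReal 0 1)[−z, z]`. -/
theorem wilson_u1JitterHMCL_batchMeans_coverage [NeZero L] (hρ : Continuous ρ) (β : ℝ) {ε₁ ε₂ κ : ℝ}
    (hε₁ : 0 < ε₁) (h12 : ε₁ ≤ ε₂) (hκ : 0 < κ) {n : ℕ} (hn : 1 ≤ n)
    {g : ℝ → GaugeConfig d L Circle → Edge d L → ℝ} (hg : Measurable fun q : ℝ × GaugeConfig d L Circle => g q.1 q.2)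
    {K : ℝ≥0} (hgK : ∀ ε ∈ Icc ε₁ ε₂, LipschitzWith K (g ε)) (hshort : 4 * (K : ℝ) * ε₂ * (n : ℝ) ^ 2 ≤ 3)
    {b : ℝ} (hb0 : 0 ≤ b) (hb : ∀ ε ∈ Icc ε₁ ε₂, ∀ U e, ‖g ε U e‖ ≤ b)
    (η : Measure ℝ) [IsProbabilityMeasure η] (hη : η (Icc ε₁ ε₂) ≠ 0)
    [IsMarkovKernel (u1JitterHMCL measurable_id hg κ (fun U : GaugeConfig d L Circle => β * wilsonAction ρ U)
          (N := fun _ => n) measurable_const η)]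
    {f : GaugeConfig d L Circle → ℝ} (hf : Measurable f) {C : ℝ} (hC : ∀ U, |f U| ≤ C)
    (hσ : 0 < (∫ y, (f y - ∫ z, f z ∂(wilsonMeasure (d := d) (L := L) ρ β)) ^ 2 ∂(wilsonMeasure (d := d) (L := L) ρ β))
              + 2 * ∑' k, ∫ y, (f y - ∫ z, f z ∂(wilsonMeasure (d := d) (L := L) ρ β))
                * (kop (u1JitterHMCL measurable_id hg κ (fun U : GaugeConfig d L Circle => β * wilsonAction ρ U)
          (N := fun _ => n) measurable_const η))^[k + 1]
                  (fun y => f y - ∫ z, f z ∂(wilsonMeasure (d := d) (L := L) ρ β)) y ∂(wilsonMeasure (d := d) (L := L) ρ β))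
    (μ₀ : Measure (GaugeConfig d L Circle)) [IsProbabilityMeasure μ₀]
    {a b' : ℕ → ℕ} (ha : Tendsto a atTop atTop) (hb' : Tendsto b' atTop atTop) {z : ℝ} (hz : 0 < z) :
    Tendsto (fun N' : ℕ => (Kernel.trajMeasure (X := fun _ : ℕ => GaugeConfig d L Circle) μ₀
              (fun t : ℕ => (u1JitterHMCL measurable_id hg κ (fun U : GaugeConfig d L Circle => β * wilsonAction ρ U)
          (N := fun _ => n) measurable_const η).comap
                (fun h : (i : ↥(Finset.Iic t)) → GaugeConfig d L Circle =>
                  h ⟨t, Finset.mem_Iic.2 le_rfl⟩) (measurable_pi_apply _))).real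
      {x | |((Real.sqrt ((b' N' * a N' : ℕ) : ℝ))⁻¹
          * ∑ t ∈ Finset.range (b' N' * a N'), (f (x t) - ∫ z, f z ∂(wilsonMeasure (d := d) (L := L) ρ β)))
        / Real.sqrt (((b' N' * a N' : ℕ) : ℝ)
          * replicaSEsq (fun j (x : ℕ → GaugeConfig d L Circle) =>
              (∑ i ∈ Finset.range (b' N'), f (x (b' N' * j + i))) / (b' N')) (a N') x)| ≤ z})
      atTop (𝓝 ((gaussianReal 0 1).real (Set.Icc (-z) z))) := by
  haveI := isProbabilityMeasure_wilsonMeasure (d := d) (L := L) ρ hρ β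
  obtain ⟨hinv, ε', hε0, hε1, hmin⟩ := wilson_u1JitterHMCL_certificate_nHit (d := d) (L := L) ρ hρ β hε₁ h12 hκ hn hg hgK hshort hb0 hb η hη
  exact Scoring.doeblinPower_batchMeans_studentized_coverage hinv hmin hε0 hε1 Nat.one_pos hf hC hσ μ₀ ha hb' hz

/-- **THE REPORTED `τ̂_int = σ̂²_BM/(2 v̂)` OF A `u1_2d` JITTERED HMC RUN IS CONSISTENT** (`Var_π f ≠ 0`, any initial law). -/
theorem wilson_u1JitterHMCL_tauInt_tendstoInMeasure [NeZero L] (hρ : Continuous ρ) (β : ℝ) {ε₁ ε₂ κ : ℝ}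
    (hε₁ : 0 < ε₁) (h12 : ε₁ ≤ ε₂) (hκ : 0 < κ) {n : ℕ} (hn : 1 ≤ n)
    {g : ℝ → GaugeConfig d L Circle → Edge d L → ℝ} (hg : Measurable fun q : ℝ × GaugeConfig d L Circle => g q.1 q.2)
    {K : ℝ≥0} (hgK : ∀ ε ∈ Icc ε₁ ε₂, LipschitzWith K (g ε)) (hshort : 4 * (K : ℝ) * ε₂ * (n : ℝ) ^ 2 ≤ 3)
    {b : ℝ} (hb0 : 0 ≤ b) (hb : ∀ ε ∈ Icc ε₁ ε₂, ∀ U e, ‖g ε U e‖ ≤ b)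
    (η : Measure ℝ) [IsProbabilityMeasure η] (hη : η (Icc ε₁ ε₂) ≠ 0)
    [IsMarkovKernel (u1JitterHMCL measurable_id hg κ (fun U : GaugeConfig d L Circle => β * wilsonAction ρ U)
          (N := fun _ => n) measurable_const η)]
    {f : GaugeConfig d L Circle → ℝ} (hf : Measurable f) {C : ℝ} (hC : ∀ U, |f U| ≤ C)
    (hvar : autocov (u1JitterHMCL measurable_id hg κ (fun U : GaugeConfig d L Circle => β * wilsonAction ρ U)
          (N := fun _ => n) measurable_const η)
        (wilsonMeasure (d := d) (L := L) ρ β) (fun y => f y - ∫ z, f z ∂(wilsonMeasure (d := d) (L := L) ρ β)) 0 ≠ 0)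
    (μ₀ : Measure (GaugeConfig d L Circle)) [IsProbabilityMeasure μ₀]
    {a b' : ℕ → ℕ} (ha : Tendsto a atTop atTop) (hb' : Tendsto b' atTop atTop) :
    TendstoInMeasure (Kernel.trajMeasure (X := fun _ : ℕ => GaugeConfig d L Circle) μ₀
              (fun t : ℕ => (u1JitterHMCL measurable_id hg κ (fun U : GaugeConfig d L Circle => β * wilsonAction ρ U)
          (N := fun _ => n) measurable_const η).comap
                (fun h : (i : ↥(Finset.Iic t)) → GaugeConfig d L Circle =>
                  h ⟨t, Finset.mem_Iic.2 le_rfl⟩) (measurable_pi_apply _)))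
      (fun (N' : ℕ) (x : ℕ → GaugeConfig d L Circle) =>
        (((b' N' * a N' : ℕ) : ℝ)
          * replicaSEsq (fun j (x : ℕ → GaugeConfig d L Circle) =>
              (∑ i ∈ Finset.range (b' N'), f (x (b' N' * j + i))) / (b' N')) (a N') x)
        / (2 * ((∑ t ∈ Finset.range (b' N' * a N'), f (x t) ^ 2) / ((b' N' * a N' : ℕ) : ℝ)
            - ((∑ t ∈ Finset.range (b' N' * a N'), f (x t)) / ((b' N' * a N' : ℕ) : ℝ)) ^ 2)))
      atTop (fun _ => tauInt (fun t =>
        autocov (u1JitterHMCL measurable_id hg κ (fun U : GaugeConfig d L Circle => β * wilsonAction ρ U)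
          (N := fun _ => n) measurable_const η)
            (wilsonMeasure (d := d) (L := L) ρ β) (fun y => f y - ∫ z, f z ∂(wilsonMeasure (d := d) (L := L) ρ β)) t
          / autocov (u1JitterHMCL measurable_id hg κ (fun U : GaugeConfig d L Circle => β * wilsonAction ρ U)
          (N := fun _ => n) measurable_const η)
            (wilsonMeasure (d := d) (L := L) ρ β) (fun y => f y - ∫ z, f z ∂(wilsonMeasure (d := d) (L := L) ρ β)) 0)) := by
  haveI := isProbabilityMeasure_wilsonMeasure (d := d) (L := L) ρ hρ β
  obtain ⟨hinv, ε', hε0, hε1, hmin⟩ := wilson_u1JitterHMCL_certificate_nHit (d := d) (L := L) ρ hρ β hε₁ h12 hκ hn hg hgK hshort hb0 hb η hη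
  exact Scoring.chain_batchMeans_tauInt_tendstoInMeasure_of_nHit hinv hmin hε0 hε1 Nat.one_pos hf hC hvar μ₀ ha hb'

end U1Jitter

end Summit.Ventures.LatticeQCDFlow.Exactness
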